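import Summits.SmoothPoincare4.SmoothPoincare4.Theses.SymplecticOrigami
import Literature.Geometry.Symplectic.EulerCharacteristicAddSignatureOfSymplecticFourProofs
import Literature.Geometry.Symplectic.FirstChernClassModTwoEqWuClassFour
import HarnessLib

/-!
# Route item `SymplecticBettiParity` (stmt-SmoothPoincare4-16622): the badge of the named fact
# `χ + σ ≡ 0 (mod 4)` for closed symplectic `4`-manifolds, and its conditional proofs

The item `Summit.SmoothPoincare4.SmoothPoincare4.Theses.SymplecticOrigami.SymplecticBettiParity`
(support, rank 7; hypothesis `hPar` of the landed `OrigamiRung_of`) is, character for character,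
the Literature named fact
`Literature.Geometry.Symplectic.even_one_add_bOne_add_bPlus_of_symplectic_four`
(`EulerCharacteristicAddSignatureOfSymplecticFour.lean`; McDuff–Salamon 2017, §13.3 p. 527:
"`χ + σ = 2 − 2b₁ + 2b⁺` is divisible by `4` … for every closed almost complex four-manifold";
Gompf–Stipsicz 1999, Thm. 1.4.15): for a closed connected symplectic `(N, s)` with its symplectic
homological orientation `μ`, `1 + b₁(N) + b⁺(μ)` is even.  This file records, on the route side,
exactly what the item costs:

* `symplecticBettiParity_iff_fact` — the item IS the named fact (`Iff.rfl`), so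
  `symplecticBettiParity_of_fact` closes it from any proof of the Literature name;
* `symplecticBettiParity_of_hirzebruch_of_wuClass` — the item from the two unproved named facts
  of the tree's reduction (`EulerCharacteristicAddSignatureOfSymplecticFourProofs.lean`):
  (H) `hirzebruch_firstChernClass_sq_eq_almostComplex_four` (`⟨c₁², [N]⟩ = 2χ + 3σ`, Hirzebruch's
  signature theorem with `⟨c₂, [N]⟩ = χ`; McDuff–Salamon Rem. 4.1.10 eq. (4.1.7)) and
  (V) `firstChernClass_modTwo_eq_wuClass_almostComplex_four` (`c₁(TN, J) ≡ v₂(N) (mod 2)`: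
  `w₂ ≡ c₁` and Wu's formula `w₂ = v₂`; Milnor–Stasheff Thm. 11.14, Problem 14-B) — CONDITIONAL;
* `symplecticBettiParity_of_hirzebruchModEight_of_integralLift` — the weakest pair of inputs the
  tree's assembly consumes: (H) only modulo `8` and (W) "`c₁(TN, J)` is characteristic", both for
  closed connected almost complex `4`-manifolds with the `J`-orientation — CONDITIONAL.

Nothing here is new mathematics; the van der Blij / Betti-number assembly is the Literature file's.

## References

* D. McDuff, D. Salamon, *Introduction to Symplectic Topology*, 3rd ed., OUP (2017), §13.3 p. 527,
  Rem. 13.3.5, Rem. 4.1.10 eq. (4.1.7). [McDuffSalamon2017]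
* R. E. Gompf, A. I. Stipsicz, *4-Manifolds and Kirby Calculus*, GSM 20, AMS (1999), Thm. 1.4.15.
  [GompfStipsiczGSM1999]
* J. Milnor, J. Stasheff, *Characteristic Classes*, Ann. of Math. Stud. 76 (1974), Thm. 11.14,
  Problem 14-B. [MilnorStasheff1974]
-/

-- the prescribed namespace `Summit.<P>.<Sub>.…` duplicates `SmoothPoincare4` (P = Sub)
set_option linter.dupNamespace false

open scoped Manifold ContDiff Topology
open Literature.AlgebraicTopology.SingularHomology Literature.Geometry.Symplectic

noncomputable section

namespace Summit.SmoothPoincare4.SmoothPoincare4.Theorems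

/-- **The item is the named fact, verbatim.**  `Theses.SymplecticOrigami.SymplecticBettiParity`
and `Literature.Geometry.Symplectic.even_one_add_bOne_add_bPlus_of_symplectic_four` are the same
proposition (`𝓡 4 = modelWithCornersSelf ℝ (EuclideanSpace ℝ (Fin 4))`, `∞ = ⊤` are notations).
[cite: McDuffSalamon2017, §13.3 p. 527 and Rem. 13.3.5] -/
theorem symplecticBettiParity_iff_fact :
    Theses.SymplecticOrigami.SymplecticBettiParity ↔
      even_one_add_bOne_add_bPlus_of_symplectic_four :=
  Iff.rfl

/-- **The item from the named fact** (one line once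
`even_one_add_bOne_add_bPlus_of_symplectic_four` is discharged in `Literature/`).
[cite: McDuffSalamon2017, §13.3 p. 527 and Rem. 13.3.5] -/
theorem symplecticBettiParity_of_fact (hT : even_one_add_bOne_add_bPlus_of_symplectic_four) :
    Theses.SymplecticOrigami.SymplecticBettiParity :=
  symplecticBettiParity_iff_fact.2 hT

/-- **The item from (H) and (V)** — CONDITIONAL on the tree's two unproved named facts
`hirzebruch_firstChernClass_sq_eq_almostComplex_four` (McDuff–Salamon 2017, Rem. 4.1.10
eq. (4.1.7): `⟨c₁(TN, J)², [N]_μ⟩ = 2χ + 3σ(μ)` for the `J`-orientation `μ`) and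
`firstChernClass_modTwo_eq_wuClass_almostComplex_four` (`c₁(TN, J) mod 2 = v₂(N)`,
Milnor–Stasheff Thm. 11.14 with Problem 14-B); the assembly (van der Blij, `χ + σ = 2(1 − b₁ + b⁺)`,
the `s`-compatible `J` inducing the symplectic orientation) is the Literature theorem
`even_one_add_bOne_add_bPlus_of_symplectic_four_of_hirzebruch_of_wuClass`.
[cite: McDuffSalamon2017, §13.3 p. 527; Rem. 4.1.10 (pp. 161–162)]
[cite: MilnorStasheff1974, Thm. 11.14 and Problem 14-B] -/
theorem symplecticBettiParity_of_hirzebruch_of_wuClass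
    (hH : hirzebruch_firstChernClass_sq_eq_almostComplex_four)
    (hV : firstChernClass_modTwo_eq_wuClass_almostComplex_four) :
    Theses.SymplecticOrigami.SymplecticBettiParity :=
  symplecticBettiParity_of_fact
    (even_one_add_bOne_add_bPlus_of_symplectic_four_of_hirzebruch_of_wuClass hH hV)

/-- **The item from the weakest inputs of the tree's assembly** — CONDITIONAL on (H) modulo `8`,
`⟨c₁(TM, J) ⌣ c₁(TM, J), [M]_μ⟩ ≡ 2χ + 3σ(μ) (mod 8)`, and (W) "`⟨c₁(TM, J), σ ⌢ [M]_μ⟩ −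
⟨σ ⌣ σ, [M]_μ⟩` is even for every `σ ∈ H²(M; ℤ)`" (`c₁` is an integral lift of `w₂ = v₂`,
McDuff–Salamon 2017 Rem. 4.1.10 p. 162), both for closed connected almost complex `4`-manifolds
with the orientation induced by `J`; given (W) the item is EQUIVALENT to (H) modulo `8` for
compatible `J` (`even_one_add_bOne_add_bPlus_of_symplectic_four_iff_hirzebruchModEight_of_forall_even`).
[cite: McDuffSalamon2017, §13.3 pp. 527–528; Rem. 4.1.10 (pp. 161–162); Rem. 4.1.12] -/
theorem symplecticBettiParity_of_hirzebruchModEight_of_integralLift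
    (hH8 : ∀ (M : Type) [TopologicalSpace M] [T2Space M] [SecondCountableTopology M]
      [CompactSpace M] [ConnectedSpace M] [ChartedSpace (EuclideanSpace ℝ (Fin 4)) M]
      [IsManifold (𝓡 4) ∞ M] (J : AlmostComplexStructure (𝓡 4) ∞ M)
      (μ : HomologicalOrientation ℤ M 4), μ.IsComplexOrientationOf J →
      cupPairing μ two_add_two_eq_four J.firstChernClass J.firstChernClass ≡
        2 * relEuler ℤ ℤ M ∅ + 3 * μ.signature [ZMOD 8])
    (hW : ∀ (M : Type) [TopologicalSpace M] [T2Space M] [SecondCountableTopology M]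
      [CompactSpace M] [ConnectedSpace M] [ChartedSpace (EuclideanSpace ℝ (Fin 4)) M]
      [IsManifold (𝓡 4) ∞ M] (J : AlmostComplexStructure (𝓡 4) ∞ M)
      (μ : HomologicalOrientation ℤ M 4), μ.IsComplexOrientationOf J →
      ∀ σ : singularCohomology ℤ ℤ M 2,
      Even (kroneckerPairing ℤ ℤ M 2 J.firstChernClass (poincareDualityMap μ two_add_two_eq_four σ) -
        cupPairing μ two_add_two_eq_four σ σ)) :
    Theses.SymplecticOrigami.SymplecticBettiParity :=
  symplecticBettiParity_of_fact
    (even_one_add_bOne_add_bPlus_of_symplectic_four_of_hirzebruchModEight_of_integralLift hH8 hW)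

end Summit.SmoothPoincare4.SmoothPoincare4.Theorems

end
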